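import Summits.Ventures.YMGap.RobustBall.PerturbedAxisCovariance
import Summits.Ventures.YMGap.RobustBall.SummableSpecification
import Literature.MathematicalPhysics.QuantumLattice.LatticeGaugeDLRProofs
import HarnessLib

/-!
# Venture YMGap, track ROBUST-BALL — ONE STATE, step 17: EVERY DLR state of a gauge-invariant member is GAUGE INVARIANT
# (every coupling, every dimension, no door; tier 1, tier 2 and the Wilson action)

HONEST FRAMING. WHAT THIS IS: a venture file (cell `pub-ymgap`, track Y2 ROBUST-BALL, seat ds-3, theorems only). The third
lattice symmetry of the one-state files (after translations/permutations/reflections) is the LOCAL GAUGE GROUP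
`U(x,k) ↦ g(x) U(x,k) g(x + e_k)⁻¹` (`gaugeTransformZd g`, tree). The tree proves gauge covariance of the Wilson kernels
(`ymSpecification_map_gaugeTransformZd_holds`) and gauge invariance of the TORUS limit points
(`map_gaugeTransformZd_of_mem_infiniteVolumeLimitPoints`). Here, on the DLR side and for the perturbed specifications:
* `perturbedYM_map_gaugeTransformZd` / `perturbedYMS_map_gaugeTransformZd` — the tier-1 / tier-2 kernels of a member whose
  terms are gauge invariant (`IsZdGaugeInvariant (W X)`) are gauge covariant (tree `tilted_map_of_measurableEquiv`,
  `map_gaugeTransformZd_pi_map_glueWith`: product Haar is invariant under two-sided translations);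
* ★★ `map_gaugeTransformZd_eq_of_mem_perturbedGibbsMeasures` — EVERY DLR state `μ` of such a member satisfies
  `μ ∘ (gaugeTransformZd g)⁻¹ = μ` for EVERY gauge transformation `g : ℤ^d → G`, at EVERY coupling (no uniqueness, no door):
  for finitely supported `g` the DLR equation in the finite volume `Λ(g)` of links touching the support and the covariance
  give `μ ∘ T_g⁻¹ = ∫ γ_Λ(· | T_g η) dμ = ∫ γ_Λ(· | η) dμ = μ` (the kernel reads the boundary field only off `Λ`, where
  `T_g η = η`); a general `g` agrees with a finitely supported one on every cylinder observable, and bounded continuous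
  cylinder integrals determine the measure (tree `measure_eq_of_integral_cylinder_eq`); tier 2:
  `map_gaugeTransformZd_eq_of_mem_perturbedGibbsMeasuresS`; WILSON (`W = 0`, every compact `G`, continuous `ρ`, `β`, `d`):
  ★ `map_gaugeTransformZd_eq_of_mem_ymGibbsMeasures` — every DLR state of lattice Yang–Mills is gauge invariant.
WHAT THIS IS NOT: nothing about uniqueness or the mass gap; lattice statements only, nothing about the continuum limit or
the Clay Millennium problem.

References: E. Seiler, LNP 159 (1982), Ch. 1–2; H.-O. Georgii (2011), §5.1, Rem. 1.24; the tree's `LatticeGaugeDLR.lean`,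
`LatticeGaugeDLRProofs.lean`; the track's `PerturbedSpecification.lean`, `SummableSpecification.lean`.
-/

noncomputable section

open MeasureTheory Filter Function
open Literature.Probability.LatticeModels hiding configShift configShift_apply
open Literature.MathematicalPhysics.QuantumLattice
open Literature.MathematicalPhysics.QuantumFieldTheory hiding ZdEdge Site

namespace Summit.Ventures.YMGap.RobustBall

/-! ### Gauge transformations: support, cylinders, kernels -/

section Geometry

variable {d : ℕ} {G : Type*} [Group G]

/-- A gauge transformation trivial off the site set `S` does not move a link with both endpoints outside `S`. [folklore] -/
theorem gaugeTransformZd_apply_of_not_mem {S : Finset (Site d)} {g : Site d → G} (hg : ∀ x, x ∉ S → g x = 1)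
    (η : LGConfig d G) {e : ZdEdge d} (h1 : e.1 ∉ S) (h2 : e.1 + Pi.single e.2 1 ∉ S) :
    gaugeTransformZd g η e = η e := by
  simp only [gaugeTransformZd, hg _ h1, hg _ h2, one_mul, inv_one, mul_one]

/-- Two gauge transformations agreeing at both endpoints of a link act identically on it. [folklore] -/
theorem gaugeTransformZd_apply_congr {g g' : Site d → G} (U : LGConfig d G) {e : ZdEdge d} (h1 : g e.1 = g' e.1)
    (h2 : g (e.1 + Pi.single e.2 1) = g' (e.1 + Pi.single e.2 1)) :
    gaugeTransformZd g U e = gaugeTransformZd g' U e := by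
  simp only [gaugeTransformZd, h1, h2]

/-- **The links touching a finite site set**: both orientations, `(x, k)` and `(x − e_k, k)` for `x ∈ S`. A link outside this
set has both endpoints outside `S`. [folklore] -/
theorem not_mem_of_not_mem_touching [DecidableEq (Site d)] (S : Finset (Site d)) {e : ZdEdge d}
    (he : e ∉ S ×ˢ (Finset.univ : Finset (Fin d)) ∪
      (S ×ˢ (Finset.univ : Finset (Fin d))).image fun xk => (xk.1 - Pi.single xk.2 1, xk.2)) :
    e.1 ∉ S ∧ e.1 + Pi.single e.2 1 ∉ S := by
  simp only [Finset.mem_union, Finset.mem_product, Finset.mem_univ, and_true, Finset.mem_image, Prod.exists,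
    not_or, not_exists, not_and] at he
  refine ⟨he.1, fun h => ?_⟩
  have := he.2 (e.1 + Pi.single e.2 1) e.2 h
  exact this (by simp)

/-- The finite-volume Hamiltonian of a member with gauge-invariant terms is gauge invariant. [folklore] -/
theorem hamiltonianIn_gaugeTransformZd {W : Potential (ZdEdge d) G} (hg : ∀ X, IsZdGaugeInvariant (W X))
    (supp : Finset (ZdEdge d) → Finset (Finset (ZdEdge d))) (Λ : Finset (ZdEdge d)) (g : Site d → G) (U : LGConfig d G) :
    hamiltonianIn W supp Λ (gaugeTransformZd g U) = hamiltonianIn W supp Λ U := by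
  classical
  unfold hamiltonianIn
  exact Finset.sum_congr rfl fun X _ => hg X g U

omit [Group G] in
/-- Gluing reads the boundary field only off the volume. [folklore] -/
theorem glueWith_congr_of_eqOn_compl {Λ : Finset (ZdEdge d)} {η η' : LGConfig d G} (h : ∀ e, e ∉ Λ → η e = η' e)
    (ζ : ↥Λ → G) : glueWith Λ ζ η = glueWith Λ ζ η' := by
  funext e
  by_cases he : e ∈ Λ
  · rw [glueWith_apply_mem _ _ _ he, glueWith_apply_mem _ _ _ he]
  · rw [glueWith_apply_not_mem _ _ _ he, glueWith_apply_not_mem _ _ _ he, h e he]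

end Geometry

/-! ### Gauge covariance of the perturbed kernels -/

section Kernels

variable {d N : ℕ} {G : Type*} [Group G] (ρ : G →* Matrix (Fin N) (Fin N) ℂ)
  [TopologicalSpace G] [IsTopologicalGroup G] [CompactSpace G] [MeasurableSpace G] [BorelSpace G]

/-- ★ **Gauge covariance of the tier-1 perturbed specification**: for a member with gauge-invariant terms,
`γ^W_Λ(· | η) ∘ (gaugeTransformZd g)⁻¹ = γ^W_Λ(· | gaugeTransformZd g η)` (as the tree's
`ymSpecification_map_gaugeTransformZd_holds`: gauge-invariant energy, two-sided-translation-invariant product Haar). [folklore] -/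
theorem perturbedYM_map_gaugeTransformZd (β : ℝ) {W : Potential (ZdEdge d) G} (hg : ∀ X, IsZdGaugeInvariant (W X))
    (supp : Finset (ZdEdge d) → Finset (Finset (ZdEdge d))) (Λ : Finset (ZdEdge d)) (η : LGConfig d G)
    (g : Site d → G) :
    (perturbedYM ρ β W supp Λ η).map (gaugeTransformZd g) = perturbedYM ρ β W supp Λ (gaugeTransformZd g η) := by
  simp only [perturbedYM]
  let e : LGConfig d G ≃ᵐ LGConfig d G :=
    { toFun := gaugeTransformZd g
      invFun := gaugeTransformZd g⁻¹
      left_inv := gaugeTransformZd_inv_gaugeTransformZd g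
      right_inv := gaugeTransformZd_gaugeTransformZd_inv g
      measurable_toFun := Literature.MathematicalPhysics.QuantumLattice.measurable_gaugeTransformZd g
      measurable_invFun := Literature.MathematicalPhysics.QuantumLattice.measurable_gaugeTransformZd g⁻¹ }
  have he : (⇑e : LGConfig d G → LGConfig d G) = gaugeTransformZd g := rfl
  have h := tilted_map_of_measurableEquiv
    ((Measure.pi fun _ : ↥Λ => haarProbability G).map (glueWith Λ · η)) e (perturbedEnergy ρ β W supp Λ) fun U => by
      show perturbedEnergy ρ β W supp Λ (gaugeTransformZd g U) = perturbedEnergy ρ β W supp Λ U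
      simp only [perturbedEnergy, wilsonBoundaryAction_gaugeTransformZd, hamiltonianIn_gaugeTransformZd hg]
  rw [he] at h
  rw [h, map_gaugeTransformZd_pi_map_glueWith]

omit [TopologicalSpace G] [IsTopologicalGroup G] [CompactSpace G] [MeasurableSpace G] [BorelSpace G] in
/-- The tier-2 energy of a member with gauge-invariant terms is gauge invariant. [folklore] -/
theorem perturbedEnergyS_gaugeTransformZd (β : ℝ) {W : Potential (ZdEdge d) G} (hg : ∀ X, IsZdGaugeInvariant (W X))
    (Λ : Finset (ZdEdge d)) (g : Site d → G) (U : LGConfig d G) :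
    perturbedEnergyS ρ β W Λ (gaugeTransformZd g U) = perturbedEnergyS ρ β W Λ U := by
  classical
  simp only [perturbedEnergyS, wilsonBoundaryAction_gaugeTransformZd]
  congr 1
  refine tsum_congr fun X => ?_
  by_cases hX : (X ∩ Λ).Nonempty
  · simp only [hX, ↓reduceIte, hg X g U]
  · simp only [hX, ↓reduceIte]

/-- ★ **Gauge covariance of the tier-2 perturbed specification** (link-summable member with gauge-invariant terms).
[folklore] -/
theorem perturbedYMS_map_gaugeTransformZd (β : ℝ) {W : Potential (ZdEdge d) G} (hg : ∀ X, IsZdGaugeInvariant (W X))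
    (Λ : Finset (ZdEdge d)) (η : LGConfig d G) (g : Site d → G) :
    (perturbedYMS ρ β W Λ η).map (gaugeTransformZd g) = perturbedYMS ρ β W Λ (gaugeTransformZd g η) := by
  simp only [perturbedYMS]
  let e : LGConfig d G ≃ᵐ LGConfig d G :=
    { toFun := gaugeTransformZd g
      invFun := gaugeTransformZd g⁻¹
      left_inv := gaugeTransformZd_inv_gaugeTransformZd g
      right_inv := gaugeTransformZd_gaugeTransformZd_inv g
      measurable_toFun := Literature.MathematicalPhysics.QuantumLattice.measurable_gaugeTransformZd g
      measurable_invFun := Literature.MathematicalPhysics.QuantumLattice.measurable_gaugeTransformZd g⁻¹ }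
  have he : (⇑e : LGConfig d G → LGConfig d G) = gaugeTransformZd g := rfl
  have h := tilted_map_of_measurableEquiv
    ((Measure.pi fun _ : ↥Λ => haarProbability G).map (glueWith Λ · η)) e (perturbedEnergyS ρ β W Λ)
    (perturbedEnergyS_gaugeTransformZd ρ β hg Λ g)
  rw [he] at h
  rw [h, map_gaugeTransformZd_pi_map_glueWith]

/-- The tier-1 kernel reads the boundary field only off the volume. [folklore] -/
theorem perturbedYM_congr_of_eqOn_compl (β : ℝ) (W : Potential (ZdEdge d) G)
    (supp : Finset (ZdEdge d) → Finset (Finset (ZdEdge d))) {Λ : Finset (ZdEdge d)} {η η' : LGConfig d G}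
    (h : ∀ e, e ∉ Λ → η e = η' e) : perturbedYM ρ β W supp Λ η = perturbedYM ρ β W supp Λ η' := by
  simp only [perturbedYM, glueWith_congr_of_eqOn_compl h]

/-- The tier-2 kernel reads the boundary field only off the volume. [folklore] -/
theorem perturbedYMS_congr_of_eqOn_compl (β : ℝ) (W : Potential (ZdEdge d) G) {Λ : Finset (ZdEdge d)}
    {η η' : LGConfig d G} (h : ∀ e, e ∉ Λ → η e = η' e) : perturbedYMS ρ β W Λ η = perturbedYMS ρ β W Λ η' := by
  simp only [perturbedYMS, glueWith_congr_of_eqOn_compl h]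

end Kernels

/-! ### Gauge invariance of every DLR state -/

section Generic

variable {d : ℕ} {G : Type*} [MeasurableSpace G]

/-- **Generic: covariant kernels reading the boundary field only off the volume ⇒ every Gibbs measure is invariant under a
transformation that fixes the boundary field off some finite volume.** For a measurable map `T` with
`γ_Λ(· | η) ∘ T⁻¹ = γ_Λ(· | T η)` and `γ_Λ(· | T η) = γ_Λ(· | η)` for all `η` (some fixed finite `Λ`), the DLR equation in `Λ`
gives `μ ∘ T⁻¹ = μ`. [folklore] -/
theorem map_eq_of_isGibbsMeasure_of_kernel_fixed {γ : Specification (ZdEdge d) G}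
    {μ : Measure (LGConfig d G)} (hμ : IsGibbsMeasure γ μ) {T : LGConfig d G → LGConfig d G} (hT : Measurable T)
    (Λ : Finset (ZdEdge d)) (hcov : ∀ η, (γ Λ η).map T = γ Λ (T η)) (hfix : ∀ η, γ Λ (T η) = γ Λ η) :
    μ.map T = μ := by
  ext A hA
  rw [Measure.map_apply hT hA, ← hμ.2 Λ _ (hT hA), ← hμ.2 Λ _ hA]
  refine lintegral_congr fun η => ?_
  rw [← Measure.map_apply hT hA, hcov η, hfix η]

end Generic

section States

variable {d N : ℕ} {G : Type*} [Group G] (ρ : G →* Matrix (Fin N) (Fin N) ℂ)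
  [TopologicalSpace G] [IsTopologicalGroup G] [CompactSpace G] [MeasurableSpace G] [BorelSpace G]

/-- ★ **Tier 1, finitely supported gauge transformations: every DLR state is invariant** — the DLR equation in the volume of
links touching the support, gauge covariance of the kernel, and the fact that the kernel reads the boundary field only
outside the volume, where the transformation is trivial. No uniqueness, every coupling. [folklore] -/
theorem map_gaugeTransformZd_eq_of_mem_perturbedGibbsMeasures_of_finite (β : ℝ) {W : Potential (ZdEdge d) G}
    (hg : ∀ X, IsZdGaugeInvariant (W X)) (supp : Finset (ZdEdge d) → Finset (Finset (ZdEdge d)))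
    {μ : Measure (LGConfig d G)} (hμ : μ ∈ perturbedGibbsMeasures (d := d) ρ β W supp) {g : Site d → G}
    {S : Finset (Site d)} (hS : ∀ x, x ∉ S → g x = 1) : μ.map (gaugeTransformZd g) = μ := by
  classical
  set Λ : Finset (ZdEdge d) := S ×ˢ (Finset.univ : Finset (Fin d)) ∪
    (S ×ˢ (Finset.univ : Finset (Fin d))).image fun xk => (xk.1 - Pi.single xk.2 1, xk.2) with hΛ
  have hμ' : IsGibbsMeasure (perturbedYM (d := d) ρ β W supp) μ := hμ
  refine map_eq_of_isGibbsMeasure_of_kernel_fixed hμ' (Literature.MathematicalPhysics.QuantumLattice.measurable_gaugeTransformZd g) Λ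
    (fun η => perturbedYM_map_gaugeTransformZd ρ β hg supp Λ η g) fun η => ?_
  refine perturbedYM_congr_of_eqOn_compl ρ β W supp fun e he => ?_
  obtain ⟨h1, h2⟩ := not_mem_of_not_mem_touching S (by rw [hΛ] at he; exact he)
  exact gaugeTransformZd_apply_of_not_mem hS η h1 h2

/-- ★ **Tier 2, finitely supported gauge transformations: every DLR state is invariant.** [folklore] -/
theorem map_gaugeTransformZd_eq_of_mem_perturbedGibbsMeasuresS_of_finite (β : ℝ) {W : Potential (ZdEdge d) G}
    (hg : ∀ X, IsZdGaugeInvariant (W X)) {μ : Measure (LGConfig d G)}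
    (hμ : μ ∈ perturbedGibbsMeasuresS (d := d) ρ β W) {g : Site d → G} {S : Finset (Site d)}
    (hS : ∀ x, x ∉ S → g x = 1) : μ.map (gaugeTransformZd g) = μ := by
  classical
  set Λ : Finset (ZdEdge d) := S ×ˢ (Finset.univ : Finset (Fin d)) ∪
    (S ×ˢ (Finset.univ : Finset (Fin d))).image fun xk => (xk.1 - Pi.single xk.2 1, xk.2) with hΛ
  have hμ' : IsGibbsMeasure (perturbedYMS (d := d) ρ β W) μ := hμ
  refine map_eq_of_isGibbsMeasure_of_kernel_fixed hμ' (Literature.MathematicalPhysics.QuantumLattice.measurable_gaugeTransformZd g) Λ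
    (fun η => perturbedYMS_map_gaugeTransformZd ρ β hg Λ η g) fun η => ?_
  refine perturbedYMS_congr_of_eqOn_compl ρ β W fun e he => ?_
  obtain ⟨h1, h2⟩ := not_mem_of_not_mem_touching S (by rw [hΛ] at he; exact he)
  exact gaugeTransformZd_apply_of_not_mem hS η h1 h2

variable [SecondCountableTopology G] [T2Space G]

/-- **From finitely supported to arbitrary gauge transformations**: if a probability measure `μ` on configuration space is
invariant under every FINITELY supported gauge transformation, it is invariant under every gauge transformation — a cylinder
observable sees `g` only through finitely many sites, and bounded continuous cylinder integrals determine the measure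
(tree `measure_eq_of_integral_cylinder_eq`). [folklore] -/
theorem map_gaugeTransformZd_eq_of_finite {μ : Measure (LGConfig d G)} [IsProbabilityMeasure μ]
    (h : ∀ (g : Site d → G) (S : Finset (Site d)), (∀ x, x ∉ S → g x = 1) → μ.map (gaugeTransformZd g) = μ)
    (g : Site d → G) : μ.map (gaugeTransformZd g) = μ := by
  classical
  haveI : IsProbabilityMeasure (μ.map (gaugeTransformZd g)) :=
    Measure.isProbabilityMeasure_map (Literature.MathematicalPhysics.QuantumLattice.measurable_gaugeTransformZd g).aemeasurable
  refine measure_eq_of_integral_cylinder_eq fun F S₀ hFS hFc hFb => ?_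
  -- the sites seen by `F`: both endpoints of its links
  set S : Finset (Site d) := S₀.image Prod.fst ∪ S₀.image (fun e => e.1 + Pi.single e.2 1) with hS
  set g' : Site d → G := fun x => if x ∈ S then g x else 1 with hg'
  have hg'S : ∀ x, x ∉ S → g' x = 1 := fun x hx => by simp only [hg', hx, ↓reduceIte]
  have hFg : ∀ U, F (gaugeTransformZd g U) = F (gaugeTransformZd g' U) := fun U => by
    refine hFS fun e he => gaugeTransformZd_apply_congr U ?_ ?_
    · have : e.1 ∈ S := Finset.mem_union_left _ (Finset.mem_image_of_mem _ (Finset.mem_coe.1 he))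
      simp only [hg', this, ↓reduceIte]
    · have : e.1 + Pi.single e.2 1 ∈ S :=
        Finset.mem_union_right _ (Finset.mem_image_of_mem (fun e : ZdEdge d => e.1 + Pi.single e.2 1) (Finset.mem_coe.1 he))
      simp only [hg', this, ↓reduceIte]
  rw [integral_map (Literature.MathematicalPhysics.QuantumLattice.measurable_gaugeTransformZd g).aemeasurable hFc.aestronglyMeasurable]
  simp_rw [hFg]
  rw [← integral_map (Literature.MathematicalPhysics.QuantumLattice.measurable_gaugeTransformZd g').aemeasurable hFc.aestronglyMeasurable, h g' S hg'S]

/-- ★★ **TIER 1: EVERY DLR STATE OF A MEMBER WITH GAUGE-INVARIANT TERMS IS GAUGE INVARIANT** — every coupling `β`, every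
dimension, every gauge transformation `g : ℤ^d → G`, no uniqueness and no door: `μ ∘ (gaugeTransformZd g)⁻¹ = μ`. [folklore] -/
theorem map_gaugeTransformZd_eq_of_mem_perturbedGibbsMeasures (β : ℝ) {W : Potential (ZdEdge d) G}
    (hg : ∀ X, IsZdGaugeInvariant (W X)) (supp : Finset (ZdEdge d) → Finset (Finset (ZdEdge d)))
    {μ : Measure (LGConfig d G)} (hμ : μ ∈ perturbedGibbsMeasures (d := d) ρ β W supp) (g : Site d → G) :
    μ.map (gaugeTransformZd g) = μ := by
  have hμ' : IsGibbsMeasure (perturbedYM (d := d) ρ β W supp) μ := hμ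
  haveI := hμ'.isProbabilityMeasure
  exact map_gaugeTransformZd_eq_of_finite
    (fun g S hS => map_gaugeTransformZd_eq_of_mem_perturbedGibbsMeasures_of_finite ρ β hg supp hμ hS) g

/-- ★★ **TIER 2: EVERY DLR STATE OF A LINK-SUMMABLE MEMBER WITH GAUGE-INVARIANT TERMS IS GAUGE INVARIANT.** [folklore] -/
theorem map_gaugeTransformZd_eq_of_mem_perturbedGibbsMeasuresS (β : ℝ) {W : Potential (ZdEdge d) G}
    (hg : ∀ X, IsZdGaugeInvariant (W X)) {μ : Measure (LGConfig d G)}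
    (hμ : μ ∈ perturbedGibbsMeasuresS (d := d) ρ β W) (g : Site d → G) : μ.map (gaugeTransformZd g) = μ := by
  have hμ' : IsGibbsMeasure (perturbedYMS (d := d) ρ β W) μ := hμ
  haveI := hμ'.isProbabilityMeasure
  exact map_gaugeTransformZd_eq_of_finite
    (fun g S hS => map_gaugeTransformZd_eq_of_mem_perturbedGibbsMeasuresS_of_finite ρ β hg hμ hS) g

/-- ★ **WILSON ACTION (every compact group, continuous representation, coupling, dimension): EVERY DLR STATE OF LATTICE
YANG–MILLS IS GAUGE INVARIANT** (the zero member; the tree has this for the torus limit points,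
`map_gaugeTransformZd_of_mem_infiniteVolumeLimitPoints`, and for the kernels, `ymSpecification_map_gaugeTransformZd_holds`).
[folklore] -/
theorem map_gaugeTransformZd_eq_of_mem_ymGibbsMeasures (β : ℝ) {μ : Measure (LGConfig d G)}
    (hμ : μ ∈ ymGibbsMeasures (d := d) ρ β) (g : Site d → G) : μ.map (gaugeTransformZd g) = μ := by
  rw [← perturbedGibbsMeasures_zero ρ β (fun _ => (∅ : Finset (Finset (ZdEdge d))))] at hμ
  exact map_gaugeTransformZd_eq_of_mem_perturbedGibbsMeasures ρ β (W := 0) (fun _ _ _ => rfl) _ hμ g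

/-- **The one state of the cell's master theorem is gauge invariant** (reading for the rows): under `PerturbedMassGapAt d N β W supp`
with gauge-invariant terms, the unique DLR state `μ` satisfies `μ ∘ (gaugeTransformZd g)⁻¹ = μ` for every `g`. [folklore] -/
theorem oneState_gaugeInvariant_of_perturbedMassGapAt {β : ℝ} {W : Potential (ZdEdge d) (SUN N)}
    {supp : Finset (ZdEdge d) → Finset (Finset (ZdEdge d))} (hgap : PerturbedMassGapAt d N β W supp)
    (hg : ∀ X, IsZdGaugeInvariant (W X)) :
    ∃ μ : Measure (LGConfig d (SUN N)),
      perturbedGibbsMeasures (d := d) (fundamentalRep (Fin N)) ((N : ℝ) * β) W supp = {μ} ∧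
        ∀ g : Site d → SUN N, μ.map (gaugeTransformZd g) = μ := by
  haveI : SecondCountableTopology (Matrix (Fin N) (Fin N) ℂ) :=
    inferInstanceAs (SecondCountableTopology (Fin N → Fin N → ℂ))
  haveI : SecondCountableTopology (SUN N) := Topology.IsEmbedding.subtypeVal.secondCountableTopology
  obtain ⟨hsub, ⟨μ, hμ⟩⟩ := hgap.1
  exact ⟨μ, Set.eq_singleton_iff_unique_mem.2 ⟨hμ, fun ν hν => hsub hν hμ⟩, fun g =>
    map_gaugeTransformZd_eq_of_mem_perturbedGibbsMeasures _ _ hg supp hμ g⟩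

end States

end Summit.Ventures.YMGap.RobustBall

end
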